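import Literature.MathematicalPhysics.QuantumFieldTheory.Balaban1983to89.B3Op116CollarRows
import Literature.MathematicalPhysics.QuantumFieldTheory.Balaban1983to89.B3Op116BoxRows
import Literature.MathematicalPhysics.QuantumFieldTheory.Balaban1983to89.B3Ineq210MixedRegularBox
import Literature.MathematicalPhysics.QuantumFieldTheory.Balaban1983to89.B3Op116SourceForm

/-!
# Bałaban, *(Higgs)₂,₃ quantum fields in a finite volume III. Renormalization* [B3] — the kernel of (1.16) p. 414 for a far-supported
perturbation `P`: THE DICTIONARY CONVERSIONS of the cell's Route δ (class (c), p. 433) — background changes `Y ↔ Y + P` of the covariant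
derivative and of the dipole source at one bond, the vanishing of `P` at far bonds, and the twice-differentiated (mixed) kernel of `G_k(Ω,X)`
resummed over the pieces (2.6) into p35's `maj` currency, on every region and on a cell-product box — file «CollarDict»

statement-level skeleton of published theorems with citation tags; proofs where landed; nothing here is a claim about the Yang–Mills mass gap

T. Bałaban, Commun. Math. Phys. **88** (1983) 411–445 [cite: Balaban1983Higgs3]; part I, Commun. Math. Phys. **85** (1982) 603–636
[cite: Balaban1982Higgs1].  PDFs held: `paper:balaban1983-higgs-2-3-quantum-fields-finite-volume` (journal page = PDF page + 410; p. 414 =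
`p0004.txt`, p. 424 = `p0014.txt`, p. 426 = `p0016.txt`, p. 433 = `p0023.txt`), `paper:balaban1982-cmp85-higgs23-i` (p. 614 = `p0012.txt`).

CITATION HEADER (lean-in-tree rule).  Cell `lit-balaban` (HOME `run/shared/lean/pub/lit-balaban/`), Phase-2 proof seat **p40** gen 77
(unit `lit-balaban-p40`, literature-prover-lit-balaban-p40-g77-0); free-target protocol G.5-34(d), TAKING line HOME/STATUS.md 2026-08-23T12:41:06Z
(cc r15 = fold owner of rows B3.Txt@433 / B3.Prop1 / B3.Eq1.16 / B3.Eq2.5, p35, r14, p33); design note `lit-balaban-p40/DESIGN-B3-116-box.md` v3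
§5.1 (e) «cross dictionary».  LOCATED SUPPORT FILE of the cell's Route δ — no head claim.  USED BY NAME, never restated: p40's
`B3Op116Pieces.{mulM, covDeriv_add_split, norm_mulM_apply_le'}`, the typer's `HiggsLattice.ChargeData.U_add` and r02's
`B2Ineq329CovariantAveraging.norm_U_sub_one_le`, p40's dipole `B3Ineq210MixedRegularTorus.dip`, r14 g17's pieces and resummation
`B3Ineq210RegularRegion.{pieceR, sum_pieceR}`, p33's `B3Ineq210MixedRegularRegion.mixedTermR`, p35 g21's box member
`B3Ineq210MixedRegularBox.ineq210_mixed_regularBox`, p35's `B3Op116MajorantStep.maj`, p40 g77's `B3Op116CollarRows.Far`.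

## What is printed

[B1] p. 614 (3.14) [PDF 12]: *"D^η_{A+B} = D^η_B + …"* — the split of the covariant derivative under a change of background (p40's
`covDeriv_add_split`: `D^ε_{A+B}φ(b) = D^ε_Bφ(b) + M_bφ(b₊)`, `‖M_b‖ ≤ |e||A_b|`).  [B3] p. 426 (2.10) [PDF 16]: *"if the propagator is differentiated,
then for each differentiation, there is an additional factor (L^jη)^{−1}"* — two differentiations give the exponent `0` in the (2.6)/(2.10) currency
(p33's `mixedTermR`, p35 g21's box member at every pair of bonds of a cell-product box).  [B3] p. 433 [PDF 23] (class (c)): the perturbation `B̃′`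
of the constant background `B̃₀` on the cube `□`; in the cell's recorded route its collar part `P` vanishes on the `k`-blocks near the localization
points, so AT those points `D^ε_Y = D^ε_{Y+P}` and `dip^Y = dip^{Y+P}` exactly, while at the collar bonds the two differ by charges `|e||P_b|`.

## What this file proves

§1 `covDeriv_congr_of_apply_eq` (`Y_b = Y′_b ⇒ D^ε_Yφ(b) = D^ε_{Y′}φ(b)`), `norm_covDeriv_le_add` (`‖D^ε_Yφ(b)‖ ≤ ‖D^ε_{P+Y}φ(b)‖ + |e||P_b|‖φ(b₊)‖`)
and its basis-summed form.  §2 `dip_add_eq` (`dip^{P+Y}_c w = dip^Y_c w + δ_{c₊}(U(−ε(P+Y)_c) − U(−εY_c))w`), `norm_dipCharge_le` (the extra one-site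
charge has norm `≤ ε|e||P_c|‖w‖`), `dip_congr_of_apply_eq`.  §3 `apply_eq_zero_of_far_src` / `_tgt`: under the far geometry of the collar rows
(every block met by `supp P` is far from `x`, margin `ρ > 0`) no bond from `x` carries `P`.  §4 `mixed_le_of_pieces`: per-piece bounds on p33's
`mixedTermR` resum to `ε^{−1}Σ_i‖(D^ε_XG_k(Ω,X)dip^X_ce_i)(b)‖ ≤ 𝔪_k(ε^dC, 0; δ₁)(b₋, c₋)` (r14's `sum_pieceR`).  §5 `mixedB_le`: the box instance at
every pair of bonds of a cell-product box (p35 g21's `ineq210_mixed_regularBox` through §4).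

## Honest scope

Elementary identities/inequalities and a repackaging of landed members; no decay or smallness is produced here.  The class-(c) use on `□` is a
RECORDED ROUTE DEVIATION from p. 433 l.12–15 (print's one-piece expansion on `□` is the cell's located open gap G-B3-16.A1).  Theorems only:
no `def`, no `def … : Prop`, no new named fact, no `sorry`; axioms standard.
-/

noncomputable section

open scoped BigOperators

namespace Literature.MathematicalPhysics.QuantumFieldTheory.Balaban1983to89.B3Op116CollarDict

open HiggsLattice (ChargeData ScalarField covDeriv)
open HiggsCovariance (propagatorK E)
open HiggsAveraging (blockIter)
open B1Eq230FluctCov (Ix cb)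
open B1TorusCubeCover (half)
open B1Ineq225RegularBox (cellBox)
open B3Ineq210MixedRegularTorus (onb dip)
open B3Ineq210RegularRegion (pieceR sum_pieceR)
open B3Ineq210MixedRegularRegion (mixedTermR)
open B3Ineq210MixedRegularBox (ineq210_mixed_regularBox)
open B3Op116Pieces (mulM covDeriv_add_split norm_mulM_apply_le')
open B3Op116MajorantStep (maj)
open B3Op116CollarRows (Far)

variable {P : HiggsLattice.Params} {N : ℕ}

/-! ## §1 The covariant derivative under the change of background `Y ↔ P + Y` at one bond -/

section CovDeriv

variable (C : ChargeData N) (A Y : HiggsLattice.VecField P 0)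

/-- `D^ε_Yφ(b) = D^ε_{Y′}φ(b)` when `Y_b = Y′_b` ((I.1.7) reads the background on the bond only). [cite: Balaban1982Higgs1, (1.7) p.605] -/
theorem covDeriv_congr_of_apply_eq {Y Y' : HiggsLattice.VecField P 0} {b : HiggsLattice.PBond P 0} (h : Y b = Y' b) (φ : ScalarField P 0 N) :
    covDeriv C Y φ b = covDeriv C Y' φ b := by
  simp only [covDeriv, h]

/-- **At a bond where `P_b = 0`: `D^ε_Yφ(b) = D^ε_{P+Y}φ(b)`.** [cite: Balaban1982Higgs1, (1.7) p.605, (3.14) p.614] [cite: Balaban1983Higgs3, p.433] -/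
theorem covDeriv_eq_covDeriv_add {b : HiggsLattice.PBond P 0} (h : A b = 0) (φ : ScalarField P 0 N) :
    covDeriv C Y φ b = covDeriv C (A + Y) φ b :=
  covDeriv_congr_of_apply_eq C (by rw [Pi.add_apply, h, zero_add]) φ

/-- **`‖D^ε_Yφ(b)‖ ≤ ‖D^ε_{P+Y}φ(b)‖ + |e||P_b|‖φ(b₊)‖`** (p40's split `D^ε_{P+Y} = D^ε_Y + M`, `‖M_bv‖ ≤ |e||P_b|‖v‖`).
[cite: Balaban1982Higgs1, (3.14) p.614] -/
theorem norm_covDeriv_le_add (φ : ScalarField P 0 N) (b : HiggsLattice.PBond P 0) :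
    ‖covDeriv C Y φ b‖ ≤ ‖covDeriv C (A + Y) φ b‖ + |C.e| * |A b| * ‖φ b.tgt‖ := by
  have h := covDeriv_add_split C A Y φ b
  have h' : covDeriv C Y φ b = covDeriv C (A + Y) φ b - mulM C A Y b (φ b.tgt) := by rw [h]; abel
  rw [h']
  exact (norm_sub_le _ _).trans (add_le_add le_rfl (norm_mulM_apply_le' C A Y b _))

/-- The basis-summed form with a sup bound `|P_b| ≤ s`: `Σ_i‖D^ε_Y(φ_i)(b)‖ ≤ Σ_i‖D^ε_{P+Y}(φ_i)(b)‖ + |e|s·Σ_i‖φ_i(b₊)‖`.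
[cite: Balaban1982Higgs1, (3.14) p.614] -/
theorem sum_norm_covDeriv_le_add {s : ℝ} {b : HiggsLattice.PBond P 0} (hA : |A b| ≤ s) {ι : Type*} (S : Finset ι)
    (φ : ι → ScalarField P 0 N) :
    ∑ i ∈ S, ‖covDeriv C Y (φ i) b‖ ≤ ∑ i ∈ S, ‖covDeriv C (A + Y) (φ i) b‖ + |C.e| * s * ∑ i ∈ S, ‖φ i b.tgt‖ := by
  rw [Finset.mul_sum, ← Finset.sum_add_distrib]
  refine Finset.sum_le_sum fun i _ => (norm_covDeriv_le_add C A Y (φ i) b).trans (add_le_add le_rfl ?_)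
  exact mul_le_mul_of_nonneg_right (mul_le_mul_of_nonneg_left hA (abs_nonneg _)) (norm_nonneg _)

end CovDeriv

/-! ## §2 The dipole source under the change of background at one bond -/

section Dipole

variable (C : ChargeData N) (A Y : HiggsLattice.VecField P 0)

/-- **`dip^{P+Y}_c w = dip^Y_c w + δ_{c₊}(U(ε,−(P+Y)_c)w − U(ε,−Y_c)w)`** (the dipole reads the background through the transport at `c₊` only).
[cite: Balaban1982Higgs1, (1.7) p.605] -/
theorem dip_add_eq (c : HiggsLattice.PBond P 0) (w : E N) :
    dip C (A + Y) c w = dip C Y c w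
      + Pi.single c.tgt (C.U (P.mesh 0) (-((A + Y) c)) w - C.U (P.mesh 0) (-(Y c)) w) := by
  simp only [dip, Pi.single_sub]
  abel

/-- **The extra one-site charge is `O(ε|e||P_c|)`**: `‖U(ε,−(P+Y)_c)w − U(ε,−Y_c)w‖ ≤ |ε·e·P_c|·‖w‖` (`U(a+b) = U(a)U(b)`, unitarity,
`‖U(ε,a) − 1‖ ≤ |εea|`). [cite: Balaban1982Higgs1, (1.7) p.605, (3.14) p.614] -/
theorem norm_dipCharge_le (c : HiggsLattice.PBond P 0) (w : E N) :
    ‖C.U (P.mesh 0) (-((A + Y) c)) w - C.U (P.mesh 0) (-(Y c)) w‖ ≤ |P.mesh 0 * C.e * A c| * ‖w‖ := by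
  have hsplit : C.U (P.mesh 0) (-((A + Y) c)) w = C.U (P.mesh 0) (-(Y c)) (C.U (P.mesh 0) (-(A c)) w) := by
    rw [Pi.add_apply, neg_add, add_comm, ChargeData.U_add]
    rfl
  rw [hsplit, ← map_sub, B3Op116Pieces.norm_U_apply]
  have h1 : C.U (P.mesh 0) (-(A c)) w - w = (C.U (P.mesh 0) (-(A c)) - 1) w := rfl
  rw [h1]
  refine (ContinuousLinearMap.le_opNorm _ _).trans (mul_le_mul_of_nonneg_right ?_ (norm_nonneg _))
  refine (B2Ineq329CovariantAveraging.norm_U_sub_one_le C (P.mesh 0) (-(A c))).trans (le_of_eq ?_)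
  rw [mul_neg, abs_neg]

/-- **At a bond where `P_c = 0`: `dip^{P+Y}_c = dip^Y_c`.** [cite: Balaban1982Higgs1, (1.7) p.605] [cite: Balaban1983Higgs3, p.433] -/
theorem dip_congr_of_apply_eq {c : HiggsLattice.PBond P 0} (h : A c = 0) (w : E N) : dip C (A + Y) c w = dip C Y c w := by
  simp only [dip, Pi.add_apply, h, zero_add]

end Dipole

/-! ## §3 Far geometry: no bond from a far point carries `P` -/

section FarZero

variable {A : HiggsLattice.VecField P 0} {k : ℕ} {ρ : ℝ}

/-- **Under the far geometry of the collar rows, `P` vanishes on every bond starting at the evaluation point**: if every site of a block met by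
`supp P` is far from `x` with margin `ρ > 0`, then `P_b = 0` whenever `b₋ = x` (a site is not far from itself). [cite: Balaban1983Higgs3, p.433] -/
theorem apply_eq_zero_of_far_src (hρ : 0 < ρ) {x x' : HiggsLattice.Site P 0}
    (hfar : ∀ b : HiggsLattice.PBond P 0, A b ≠ 0 → ∀ z : HiggsLattice.Site P 0, blockIter k z = blockIter k b.src →
      Far P k ρ x z ∧ Far P k ρ z x')
    {b : HiggsLattice.PBond P 0} (hb : b.src = x) : A b = 0 := by
  by_contra h
  have hf := (hfar b h b.src rfl).1
  rw [hb] at hf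
  unfold Far at hf
  rw [B1Ineq234Concrete.tdist_self, Nat.cast_zero, mul_zero] at hf
  exact absurd hf (not_le.mpr (mul_pos (P.mesh_pos k) hρ))

/-- The same at the test point: `P_c = 0` whenever `c₋ = x′`. [cite: Balaban1983Higgs3, p.433] -/
theorem apply_eq_zero_of_far_tgt (hρ : 0 < ρ) {x x' : HiggsLattice.Site P 0}
    (hfar : ∀ b : HiggsLattice.PBond P 0, A b ≠ 0 → ∀ z : HiggsLattice.Site P 0, blockIter k z = blockIter k b.src →
      Far P k ρ x z ∧ Far P k ρ z x')
    {c : HiggsLattice.PBond P 0} (hc : c.src = x') : A c = 0 := by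
  by_contra h
  have hf := (hfar c h c.src rfl).2
  rw [hc] at hf
  unfold Far at hf
  rw [B1Ineq234Concrete.tdist_self, Nat.cast_zero, mul_zero] at hf
  exact absurd hf (not_le.mpr (mul_pos (P.mesh_pos k) hρ))

end FarZero

/-! ## §4 The twice-differentiated (mixed) kernel of `G_k(Ω,X)` resummed over the pieces (2.6) -/

section Mixed

variable {C : ChargeData N} {Ω : Finset (HiggsLattice.Site P 0)} {X : HiggsLattice.VecField P 0} {msq a : ℝ} {k : ℕ} {δ₁ Cst : ℝ}

/-- **Mixed entry**: if every piece satisfies the twice-differentiated (2.10) at the bonds `⟨x,μ⟩`, `⟨x′,ν⟩` in p33's units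
(`mixedTermR_j ≤ C(L^jε)^{−d}e^{−δ₁|x−x′|/L^j}`), then `ε^{−1}Σ_i‖(D^ε_XG_k(Ω,X)dip^X_{⟨x′,ν⟩}e_i)(⟨x,μ⟩)‖ ≤ 𝔪_k(ε^dC, 0; δ₁)(x, x′)` — the `K^D` /
`D`-inputs of the collar rows (`B3Op116CollarKernel.deriv_row_collar_le`) in p35's currency. [cite: Balaban1983Higgs3, (2.6) p.424, (2.10) p.426] -/
theorem mixed_le_of_pieces (hmsq : 0 < msq) (ha : 0 < a) (hL1 : 1 < P.L) (hk : 1 ≤ k) (hkK : k ≤ P.K)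
    {μ ν : Fin P.d} {x x' : HiggsLattice.Site P 0}
    (hm : ∀ j : ℕ, mixedTermR C Ω X msq a k j μ ν x x'
      ≤ Cst * (P.mesh j ^ P.d)⁻¹ * Real.exp (-(δ₁ * ((HiggsLattice.Site.tdist x x' : ℝ) / (P.L : ℝ) ^ j)))) :
    (P.mesh 0)⁻¹ * ∑ i : Ix N, ‖covDeriv C X (propagatorK C Ω X msq a k (dip C X ⟨x', ν⟩ (onb N i))) ⟨x, μ⟩‖
      ≤ maj P k (P.mesh 0 ^ P.d * Cst) 0 δ₁ x x' := by
  have hmd : 0 < P.mesh 0 ^ P.d := pow_pos (P.mesh_pos 0) _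
  have hε0 : 0 ≤ (P.mesh 0)⁻¹ := inv_nonneg.mpr (P.mesh_pos 0).le
  rw [← sum_pieceR (C := C) (Ω := Ω) (A := X) (a := a) hmsq ha hL1 hk hkK]
  unfold maj
  calc (P.mesh 0)⁻¹ * ∑ i : Ix N, ‖covDeriv C X ((∑ j ∈ Finset.range k, pieceR C Ω X msq a k j) (dip C X ⟨x', ν⟩ (onb N i))) ⟨x, μ⟩‖
      = (P.mesh 0)⁻¹ * ∑ i : Ix N, ‖∑ j ∈ Finset.range k, covDeriv C X (pieceR C Ω X msq a k j (dip C X ⟨x', ν⟩ (onb N i))) ⟨x, μ⟩‖ := by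
        congr 1
        refine Finset.sum_congr rfl fun i _ => ?_
        rw [LinearMap.sum_apply, B3Ineq210RegularTorus.covDeriv_sum'']
    _ ≤ (P.mesh 0)⁻¹ * ∑ i : Ix N, ∑ j ∈ Finset.range k, ‖covDeriv C X (pieceR C Ω X msq a k j (dip C X ⟨x', ν⟩ (onb N i))) ⟨x, μ⟩‖ :=
        mul_le_mul_of_nonneg_left (Finset.sum_le_sum fun i _ => norm_sum_le _ _) hε0
    _ = ∑ j ∈ Finset.range k, (P.mesh 0)⁻¹ * ∑ i : Ix N, ‖covDeriv C X (pieceR C Ω X msq a k j (dip C X ⟨x', ν⟩ (onb N i))) ⟨x, μ⟩‖ := by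
        rw [Finset.sum_comm, Finset.mul_sum]
    _ ≤ _ := Finset.sum_le_sum fun j _ => ?_
  -- one piece: p33's `mixedTermR` times `ε^d`
  have h := hm j
  have hunit : mixedTermR C Ω X msq a k j μ ν x x'
      = (P.mesh 0 ^ P.d)⁻¹ * ((P.mesh 0)⁻¹ *
          ∑ i : Ix N, ‖covDeriv C X (pieceR C Ω X msq a k j (dip C X ⟨x', ν⟩ (onb N i))) ⟨x, μ⟩‖) := rfl
  rw [hunit, inv_mul_le_iff₀ hmd] at h
  refine h.trans (le_of_eq ?_)
  rw [B3Op116ScaleChains.rate_eq, zero_sub, Real.rpow_neg (P.mesh_pos j).le, Real.rpow_natCast]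
  ring_nf

end Mixed

/-! ## §5 The box instance: every pair of bonds of a cell-product box -/

section Box

/-- **The mixed kernel of `G_k(Ω,X)` on a cell-product box in p35's `maj` currency**, at EVERY pair of bonds `⟨x,μ⟩, ⟨x′,ν⟩ ⊂ Ω`: for `d ≥ 1`,
`L ≥ 2`, `a, m² > 0`, `N`, every charge: ∃ `K₀,min`, ∀ `K₀ ≥ K₀,min` ∃ `t, δ₁, C > 0` such that for every volume with these `d, L`, `K₀ ∣ M`, every
`1 ≤ k ≤ K` with `L^kε ≤ 1`, `3L^kK₀ ≤ |T_ε|_μ`, every `S` and every `X` `δ`-regular on `Ω = cellBox k K₀ S` with `L^kδ|e| ≤ t`: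
`ε^{−1}Σ_i‖(D^ε_XG_k(Ω,X)dip^X_{⟨x′,ν⟩}e_i)(⟨x,μ⟩)‖ ≤ 𝔪_k(ε^dC, 0; δ₁)(x,x′)` (p35 g21's `ineq210_mixed_regularBox` + §4).
[cite: Balaban1983Higgs3, (2.6) p.424, (2.10) p.426, (1.16) p.414] [cite: Balaban1982Higgs1, Prop. 2.1 p.610, p.611 l.1–2] -/
theorem mixedB_le (d L : ℕ) (hd : 1 ≤ d) (hL : 2 ≤ L) {a : ℝ} (ha : 0 < a) {msq : ℝ} (hmsq : 0 < msq) (N : ℕ) (C : ChargeData N) :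
    ∃ K₀min : ℕ, ∀ K₀ : ℕ, K₀min ≤ K₀ → ∃ t δ₁ Cst : ℝ, 0 < t ∧ 0 < δ₁ ∧ 0 < Cst ∧
      ∀ (P : HiggsLattice.Params), 1 < P.L → P.d = d → P.L = L → K₀ ∣ P.M →
      ∀ {k : ℕ}, 1 ≤ k → k ≤ P.K → (∀ μ, 3 * half P k K₀ ≤ P.sitesPerDir 0 μ) → P.mesh k ≤ 1 →
      ∀ (S : Fin P.d → Finset ℕ) (X : HiggsLattice.VecField P 0) {δA : ℝ}, 0 ≤ δA →
        (∀ z ∈ cellBox k K₀ S, ∀ μ ν : Fin P.d, |X ⟨z.shift ν, μ⟩ - X ⟨z, μ⟩| ≤ δA) →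
        (P.L : ℝ) ^ k * δA * |C.e| ≤ t →
        ∀ (μ ν : Fin P.d) (x x' : HiggsLattice.Site P 0),
          x ∈ cellBox k K₀ S → x.shift μ ∈ cellBox k K₀ S → x' ∈ cellBox k K₀ S → x'.shift ν ∈ cellBox k K₀ S →
          (P.mesh 0)⁻¹ * ∑ i : Ix N, ‖covDeriv C X (propagatorK C (cellBox k K₀ S) X msq a k (dip C X ⟨x', ν⟩ (onb N i))) ⟨x, μ⟩‖
            ≤ maj P k (P.mesh 0 ^ P.d * Cst) 0 δ₁ x x' := by
  obtain ⟨K₀min, h⟩ := ineq210_mixed_regularBox d L hd hL ha hmsq N C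
  refine ⟨K₀min, fun K₀ hK₀ => ?_⟩
  obtain ⟨t, δ₁, Cst, ht, hδ₁, hCst, h⟩ := h K₀ hK₀
  refine ⟨t, δ₁, Cst, ht, hδ₁, hCst, ?_⟩
  intro P hP1 hPd hPL hK₀M k hk1 hkK h3 hmesh S X δA hδA hreg ht' μ ν x x' hx hxμ hx' hx'ν
  exact mixed_le_of_pieces hmsq ha hP1 hk1 hkK (fun j => h P hPd hPL hK₀M hk1 hkK h3 hmesh S X hδA hreg ht' j μ ν x x' hx hxμ hx' hx'ν)

end Box

end Literature.MathematicalPhysics.QuantumFieldTheory.Balaban1983to89.B3Op116CollarDict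

end
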